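import Summits.HodgeConjecture.HodgeConjecture.Theorems.F0P3cStCharTSShellOn           -- ★ «FLIP-OFF★» `hflip_of_antiOriented` (the `hflip` text of ★ p849876)
import Summits.HodgeConjecture.HodgeConjecture.Theorems.F0P3cStCharTSHtauOnCoset       -- ★ p849908 (this seat): the BOX text (`torusEntry`, `finGammaTwo`), ★ `exp_neg_succ_le_one`
import Literature.NumberTheory.Automorphic.CMBorelWeylTorusConjugateTwo                  -- ★ `weylConj_mem_cmTorus_two`, `glDiagonal_rev_eq_weylConj_two`
import HarnessLib

/-!
# F0 · P3c · line LH6 «StCharTS» — road (D) «DEEP-FL», «HFLIP-OF-COVER★»: the `hflip` clause of ★ p849876 for the DOMINANT cosets `C′ u = u♭ • S′` of the cover,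
# from ★ XIG-DATA-LEVELS' BOX and hyperbolic-reps conjuncts (★ FLIP-OFF `hflip_of_antiOriented` instantiated)

Cell `pub/hodgecm-mathlib`, crux H413 = `stmt-HodgeConjecture-24833` (lane `--supports … --as helper`), route HCCMUnconditional; seat LH6-p03 (g2); default brick after KNOCK
2026-09-02T07:53Z (the `?hflip` slot of A-p16 (g34)'s XIG-ASSEMBLY head draft v5 361780d74c9050c0 at ★ HOH-FLIP's `C′ u := D u = (w₂ u.1 w₂⁻¹, u.2)·(C₂ × K₁)`).  THEOREMS ONLY,
sorry-free, ★-only imports; no definition ∕ instance ∕ notation ∕ named fact.  HONEST LABEL: HC_CM is proved only modulo the 7 printed citations (2 remaining: hLiu418 =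
stmt-HodgeConjecture-24832, h413 = stmt-HodgeConjecture-24833) until rung 0 closes; count-neutral plumbing of road (D).

THE MATHEMATICS ([Rogawski1990, §4.9 (4.9.4) p. 56; §12.7 L. 12.7.3 (proof) p. 195]).  Each representative `u ∈ F` of the cover is hlevi-ORIENTED (`u.1 = diag(d′₀, d′₁)`,
`|d′₁|_w < |d′₀|_w`, ★ REP-HYPERBOLIC), so its Weyl flip `u♭ = (w₂ u.1 w₂⁻¹, u.2)` has the REVERSED diagonal (★ `glDiagonal_rev_eq_weylConj_two`) and is ANTI-oriented; the `H`-level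
`S′` sits in the level-`nμ` box (★ XIG-DATA-LEVELS BOX), in particular in the unit box.  ★ `hflip_of_antiOriented` then says the oriented stratum never meets `u♭ • S′` — the
`hflip` hypothesis of ★ `isLocalDeltaTransfer_doubleCosetSum_of_checklist` for `C′ u := u♭ • ↑S′`.

## References
* [Rogawski1990] J. D. Rogawski, *Automorphic Representations of Unitary Groups in Three Variables*, Ann. of Math. Stud. 123 (1990): §4.9 (4.9.4) p. 56; §12.7 Lemma 12.7.3
  (proof) p. 195; §1.10 p. 9.
-/

set_option autoImplicit false
-- the mandated namespace has the single-problem summit's repeated segment (`HodgeConjecture.HodgeConjecture`)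
set_option linter.dupNamespace false

noncomputable section

open Matrix NumberField IsDedekindDomain
open scoped MatrixGroups Pointwise
open Literature.NumberTheory.Rogawski1990 Literature.NumberTheory.Automorphic Literature.NumberTheory.Automorphic.UnitaryGroup
open Literature.NumberTheory.GaloisRepresentations

namespace Summit.HodgeConjecture.HodgeConjecture.Cruxes.H413.F0P3cStCharTSHflipOfCover

variable (L : Type) [Field L] [NumberField L] [IsCMField L] (v : HeightOneSpectrum (𝓞 ↥(maximalRealSubfield L)))
  (w : PlacesOver L v) (hw : IsCMField.complexConj L • w.1 = w.1)

/-! ## §1 The flip of an oriented torus point is anti-oriented -/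

/-- **The diagonal of the flip is reversed**: if `u₁ = diag(d′)` in `T₂` then any diagonal writing `e` of `w₂ u₁ w₂⁻¹` has `e 0 = d′ 1`, `e 1 = d′ 0`
(★ `glDiagonal_rev_eq_weylConj_two`, diagonal entries read by ★ `torusEntry_eq_of_glDiagonal_eq`). [cite: Rogawski1990, §1.10 p. 9] -/
theorem diag_flip_eq (w₂ : ↥(unitaryGroupOfForm (conjLocal L (IsCMField.complexConj L) v) (cmLocalForm L 2 v)))
    (hw₂ : Units.val (w₂ : GL (Fin 2) (LocalRing L v)) = cmLocalForm L 2 v)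
    (u₁ : ↥(cmBorelTriple L 2 v).M) {d' e : Fin 2 → (LocalRing L v)ˣ}
    (hd' : glDiagonal 2 (LocalRing L v) d' = ((u₁ : ↥(unitaryGroupOfForm (conjLocal L (IsCMField.complexConj L) v) (cmLocalForm L 2 v))) : GL (Fin 2) (LocalRing L v)))
    (he : glDiagonal 2 (LocalRing L v) e =
      ((((⟨w₂ * (u₁ : ↥(unitaryGroupOfForm (conjLocal L (IsCMField.complexConj L) v) (cmLocalForm L 2 v))) * w₂⁻¹, weylConj_mem_cmTorus_two L v w₂ hw₂ u₁⟩ :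
        ↥(cmBorelTriple L 2 v).M) : ↥(unitaryGroupOfForm (conjLocal L (IsCMField.complexConj L) v) (cmLocalForm L 2 v))) : GL (Fin 2) (LocalRing L v)))) :
    e 0 = d' 1 ∧ e 1 = d' 0 := by
  have hrev := glDiagonal_rev_eq_weylConj_two (conjLocal L (IsCMField.complexConj L) v) (cmLocalForm_eq_over L 2 v) w₂ hw₂ u₁ hd'
  have h := fun i => (torusEntry_eq_of_glDiagonal_eq (conjLocal L (IsCMField.complexConj L) v) (cmLocalForm L 2 v) i
    ⟨w₂ * (u₁ : ↥(unitaryGroupOfForm (conjLocal L (IsCMField.complexConj L) v) (cmLocalForm L 2 v))) * w₂⁻¹, weylConj_mem_cmTorus_two L v w₂ hw₂ u₁⟩ e he).symm.trans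
    (torusEntry_eq_of_glDiagonal_eq (conjLocal L (IsCMField.complexConj L) v) (cmLocalForm L 2 v) i
      ⟨w₂ * (u₁ : ↥(unitaryGroupOfForm (conjLocal L (IsCMField.complexConj L) v) (cmLocalForm L 2 v))) * w₂⁻¹, weylConj_mem_cmTorus_two L v w₂ hw₂ u₁⟩ (fun i => d' i.rev) hrev)
  exact ⟨(h 0).trans (congrArg d' (by decide)), (h 1).trans (congrArg d' (by decide))⟩

/-! ## §2 `hflip` for the dominant cosets of the cover -/

include hw in
set_option maxHeartbeats 1600000 in  -- statement-level `whnf` on the CM carriers (same class as ★ `hflip_of_antiOriented`)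
/-- **«HFLIP-OF-COVER★»** — the `hflip` hypothesis of ★ p849876 `isLocalDeltaTransfer_doubleCosetSum_of_checklist` VERBATIM as conclusion, for the index `s := F` and the DOMINANT cosets
`C′ u := ((⟨w₂ ↑u.1 w₂⁻¹, _⟩ : ↥T₂), u.2) • ↑S′`, from: the BOX property of `S′` at some level `nμ` (★ XIG-DATA-LEVELS conjunct, ★ p849908's antecedent VERBATIM) and the hlevi-orientation of
the representatives (★ REP-HYPERBOLIC ∕ ★ XIG-DATA-LEVELS (e), KIT-B shape `∃ d′, glDiagonal d′ = ↑u.1 ∧ |d′₁|_w < |d′₀|_w ∧ σ_w(d′₀)d′₁ = 1`).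
[cite: Rogawski1990, §4.9 (4.9.4) p. 56; §12.7 Lemma 12.7.3 (proof) p. 195] -/
theorem hflip_of_cover (w₂ : ↥(unitaryGroupOfForm (conjLocal L (IsCMField.complexConj L) v) (cmLocalForm L 2 v)))
    (hw₂ : Units.val (w₂ : GL (Fin 2) (LocalRing L v)) = cmLocalForm L 2 v)
    (S' : Subgroup (↥(cmBorelTriple L 2 v).M × (cmDatum L 1 (Matrix.of fun i j : Fin 1 => if i.val + j.val + 1 = 1 then (1 : L) else 0)).Local v)) {nμ : ℕ}
    (hbox : ∀ k ∈ S', (∀ i : Fin 2, ∀ w' : PlacesOver L v,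
        Valued.v (((torusEntry (conjLocal L (IsCMField.complexConj L) v) (cmLocalForm L 2 v) i k.1 : (LocalRing L v)ˣ) : LocalRing L v) w' - 1) <
          WithZero.exp (-((nμ + 1 : ℕ) : ℤ))) ∧
      (∀ w' : PlacesOver L v,
        Valued.v (finGammaTwo L v ((k.1 : ↥(unitaryGroupOfForm (conjLocal L (IsCMField.complexConj L) v) (cmLocalForm L 2 v))), k.2) w' - 1) <
          WithZero.exp (-((nμ + 1 : ℕ) : ℤ))))
    (F : Finset (↥(cmBorelTriple L 2 v).M × (cmDatum L 1 (Matrix.of fun i j : Fin 1 => if i.val + j.val + 1 = 1 then (1 : L) else 0)).Local v))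
    (hhyp : ∀ u ∈ F, ∃ d' : Fin 2 → (LocalRing L v)ˣ,
      glDiagonal 2 (LocalRing L v) d' = ((u.1 : ↥(unitaryGroupOfForm (conjLocal L (IsCMField.complexConj L) v) (cmLocalForm L 2 v))) : GL (Fin 2) (LocalRing L v)) ∧
      Valued.v (((d' 1 : (LocalRing L v)ˣ) : LocalRing L v) w) < Valued.v (((d' 0 : (LocalRing L v)ˣ) : LocalRing L v) w) ∧
      galAdicCompletionMap (L := L) (IsCMField.complexConj L) hw (((d' 0 : (LocalRing L v)ˣ) : LocalRing L v) w) * ((d' 1 : (LocalRing L v)ˣ) : LocalRing L v) w = 1) :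
    ∀ (γH : ((cmDatum L 2 (Matrix.of fun i j : Fin 2 => if i.val + j.val + 1 = 2 then (1 : L) else 0)).Local v × (cmDatum L 1 (Matrix.of fun i j : Fin 1 => if i.val + j.val + 1 = 1 then (1 : L) else 0)).Local v))
      (d' : Fin 2 → (LocalRing L v)ˣ), glDiagonal 2 (LocalRing L v) d' = ((γH.1).val : GL (Fin 2) (LocalRing L v)) → IsLocalGRegular L v γH →
      Valued.v (((d' 1 : (LocalRing L v)ˣ) : LocalRing L v) w) < Valued.v (((d' 0 : (LocalRing L v)ˣ) : LocalRing L v) w) →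
      galAdicCompletionMap (L := L) (IsCMField.complexConj L) hw (((d' 0 : (LocalRing L v)ˣ) : LocalRing L v) w) * ((d' 1 : (LocalRing L v)ˣ) : LocalRing L v) w = 1 →
      ∀ (tH : ↥(cmBorelTriple L 2 v).M), (tH : ↥(unitaryGroupOfForm (conjLocal L (IsCMField.complexConj L) v) (cmLocalForm L 2 v))) = γH.1 →
      ∀ j ∈ F, (tH, γH.2) ∉
        (((⟨w₂ * (j.1 : ↥(unitaryGroupOfForm (conjLocal L (IsCMField.complexConj L) v) (cmLocalForm L 2 v))) * w₂⁻¹, weylConj_mem_cmTorus_two L v w₂ hw₂ j.1⟩ :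
            ↥(cmBorelTriple L 2 v).M), j.2) : ↥(cmBorelTriple L 2 v).M × (cmDatum L 1 (Matrix.of fun i j : Fin 1 => if i.val + j.val + 1 = 1 then (1 : L) else 0)).Local v) •
          (S' : Set (↥(cmBorelTriple L 2 v).M × (cmDatum L 1 (Matrix.of fun i j : Fin 1 => if i.val + j.val + 1 = 1 then (1 : L) else 0)).Local v)) := by
  refine F0P3cStCharTSShellOn.hflip_of_antiOriented L v w hw F
    (fun j => (((⟨w₂ * (j.1 : ↥(unitaryGroupOfForm (conjLocal L (IsCMField.complexConj L) v) (cmLocalForm L 2 v))) * w₂⁻¹, weylConj_mem_cmTorus_two L v w₂ hw₂ j.1⟩ :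
        ↥(cmBorelTriple L 2 v).M), j.2)))
    S' _ (fun j _ => rfl) ?_ ?_
  · -- the flips are ANTI-oriented
    intro j hj e he
    obtain ⟨d₀, hd₀, hlt, -⟩ := hhyp j hj
    obtain ⟨h0, h1⟩ := diag_flip_eq L v w₂ hw₂ j.1 hd₀ he
    rw [h0, h1]
    exact hlt
  · -- `S′` lies in the unit box at `w`
    intro k hk e he i
    have h := (hbox k hk).1 i w
    rw [torusEntry_eq_of_glDiagonal_eq _ _ i k.1 e he] at h
    exact lt_of_lt_of_le h (F0P3cStCharTSDeltaCosetConst.exp_neg_succ_le_one nμ)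

end Summit.HodgeConjecture.HodgeConjecture.Cruxes.H413.F0P3cStCharTSHflipOfCover

end
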